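import Mathlib
import Literature.MathematicalPhysics.QuantumManyBody.BoseEinsteinCondensation
import Summits.AtomisticToContinuum.BoseEinsteinCondensation.Theorems.SoloBlindBhattacharyya
import Summits.AtomisticToContinuum.BoseEinsteinCondensation.Theorems.SoloBlindEntropicPenroseOnsager
import Summits.AtomisticToContinuum.BoseEinsteinCondensation.Theorems.SoloBlindJensenAffinity

/-!
# The entropic Penrose–Onsager criterion for `BoseGas.TrialState`s

Solo seat `solo-AtomisticToContinuum-blind`, conjunct `BoseEinsteinCondensation`.  This file
connects the criteria of `SoloBlindJensenAffinity` to the objects of the Literature statement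
`BoseGas.BoseEinsteinCondensation`: the `(n+1)`-particle configuration integral is split as
`∫ dX = ∫ dY ∫ dx` along `X = x :: Y` (`lintegral_eq_lintegral_lintegral_vecCons`, from the
measure-preserving equivalence `Fin.insertNthEquiv`), so that the normalisation
`TrialState.norm_eq` feeds the criteria directly.  Result (`TrialState` version of the
mutual-information criterion):

* `TrialState.mul_exp_neg_le_maxOccupation_of_klDiv_symm_le` : for a trial state `Ψ` whose wave
  function is real and nonnegative, `Ψ.ψ = Φ ≥ 0`, and a normalised mode `g ≥ 0`: if the relative
  entropy of the Born law `|Φ|²` (in the coordinates `(x, Y)`) with respect to the resampled law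
  `g² ⊗ P̂` is `≤ K`, then `(n+1) · e^{-K} ≤ maxOccupation (n+1) Ψ.ψ`;
* `TrialState.mul_exp_neg_le_maxOccupation_of_klDiv_le` : the same with `KL(g² ⊗ P̂ ‖ |Φ|²)`.

Together with `BoseGas.le_condensateNumber` this is the form in which an `N`-uniform entropy
bound along near-minimisers would give `HasGroundStateBEC`; the missing analytic input (such a
uniform bound at fixed small density) is the open problem.
-/

open MeasureTheory InformationTheory
open scoped ENNReal

namespace Summit.AtomisticToContinuum.BoseEinsteinCondensation.Theorems

open Literature.MathematicalPhysics.QuantumManyBody.BoseGas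

/-- The measurable equivalence `Space × Config n ≃ᵐ Config (n+1)`, `(x, Y) ↦ x :: Y`, preserves
Lebesgue measure. -/
theorem measurePreserving_vecCons (n : ℕ) :
    MeasurePreserving (fun z : Space × Config n => (Matrix.vecCons z.1 z.2 : Config (n + 1)))
      ((volume : Measure Space).prod (volume : Measure (Config n))) volume := by
  have h := (volume_preserving_piFinSuccAbove (fun _ : Fin (n + 1) => Space) 0).symm
  have heq : (fun z : Space × Config n => (Matrix.vecCons z.1 z.2 : Config (n + 1))) =
      ⇑(MeasurableEquiv.piFinSuccAbove (fun _ : Fin (n + 1) => Space) 0).symm := by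
    funext z
    simp [MeasurableEquiv.piFinSuccAbove]
    rfl
  rw [heq]
  exact h

/-- Splitting off the first particle: `∫ F(X) dX = ∫ dY ∫ dx F(x :: Y)`. -/
theorem lintegral_eq_lintegral_lintegral_vecCons {n : ℕ} {F : Config (n + 1) → ℝ≥0∞}
    (hF : Measurable F) :
    ∫⁻ X, F X = ∫⁻ Y : Config n, ∫⁻ x : Space, F (Matrix.vecCons x Y) := by
  rw [← (measurePreserving_vecCons n).lintegral_comp hF,
    lintegral_prod_symm (fun z : Space × Config n => F (Matrix.vecCons z.1 z.2))
      (hF.comp measurable_vecCons).aemeasurable]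

/-- Product-space form: `∫ F(X) dX = ∫ F(x :: Y) d(x, Y)`. -/
theorem lintegral_eq_lintegral_prod_vecCons {n : ℕ} {F : Config (n + 1) → ℝ≥0∞}
    (hF : Measurable F) :
    ∫⁻ X, F X = ∫⁻ z, F (Matrix.vecCons z.1 z.2)
      ∂((volume : Measure Space).prod (volume : Measure (Config n))) :=
  ((measurePreserving_vecCons n).lintegral_comp hF).symm

namespace TrialState

/-- A trial state with real nonnegative wave function `Φ`: `Φ` is measurable. -/
theorem measurable_of_eq_ofReal {N : ℕ} {L : ℝ} (Ψ : TrialState N L) {Φ : Config N → ℝ}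
    (hΨΦ : Ψ.ψ = fun X => (Φ X : ℂ)) : Measurable Φ := by
  have h : Measurable fun X => (Ψ.ψ X).re :=
    Complex.measurable_re.comp Ψ.contDiff.continuous.measurable
  simpa [hΨΦ] using h

/-- A trial state with real nonnegative wave function `Φ`: `∫ Φ² = 1` in the split coordinates. -/
theorem lintegral_lintegral_sq_eq_one {n : ℕ} {L : ℝ} (Ψ : TrialState (n + 1) L)
    {Φ : Config (n + 1) → ℝ} (hΦ0 : 0 ≤ Φ) (hΨΦ : Ψ.ψ = fun X => (Φ X : ℂ)) :
    ∫⁻ Y : Config n, ∫⁻ x, ENNReal.ofReal (Φ (Matrix.vecCons x Y)) ^ 2 = 1 := by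
  have hΦm := measurable_of_eq_ofReal Ψ hΨΦ
  have h1 := Ψ.norm_eq
  simp_rw [hΨΦ, coe_nnnorm_ofReal_of_nonneg (hΦ0 _)] at h1
  rwa [lintegral_eq_lintegral_lintegral_vecCons (hΦm.ennreal_ofReal.pow_const 2)] at h1

/-- **Entropic Penrose–Onsager criterion for trial states (resampling direction).**
Let `Ψ` be an `(n+1)`-boson trial state with real nonnegative wave function `Φ`, `g ≥ 0` a
normalised one-particle mode, `𝐏` the Born law `Φ(x :: Y)² d(x, Y)` and `𝐐 = g² ⊗ P̂` its
one-particle resampling.  If `KL(𝐐 ‖ 𝐏) ≤ K` then `(n+1) · e^{-K} ≤ maxOccupation (n+1) Ψ.ψ`. -/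
theorem mul_exp_neg_le_maxOccupation_of_klDiv_le {n : ℕ} {L : ℝ} (Ψ : TrialState (n + 1) L)
    {Φ : Config (n + 1) → ℝ} (hΦ0 : 0 ≤ Φ) (hΨΦ : Ψ.ψ = fun X => (Φ X : ℂ))
    {g : Space → ℝ} (hg0 : 0 ≤ g) (hgm : Measurable g)
    (hint : ∀ Y : Config n, Integrable (fun x => g x * Φ (Matrix.vecCons x Y)))
    (hg1 : ∫⁻ x, ENNReal.ofReal (g x) ^ 2 = 1) {K : ℝ} (hK0 : 0 ≤ K)
    (hK : klDiv
        (((volume : Measure Space).prod (volume : Measure (Config n))).withDensity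
          fun z => ENNReal.ofReal (g z.1) ^ 2 *
            ∫⁻ y, ENNReal.ofReal (Φ (Matrix.vecCons y z.2)) ^ 2)
        (((volume : Measure Space).prod (volume : Measure (Config n))).withDensity
          fun z => ENNReal.ofReal (Φ (Matrix.vecCons z.1 z.2)) ^ 2) ≤ ENNReal.ofReal K) :
    (n + 1 : ℝ≥0∞) * ENNReal.ofReal (Real.exp (-K)) ≤ maxOccupation (n + 1) Ψ.ψ := by
  rw [hΨΦ]
  exact Theorems.mul_exp_neg_le_maxOccupation_of_klDiv_le hg0 hΦ0 hgm
    (measurable_of_eq_ofReal Ψ hΨΦ) hint hg1 (lintegral_lintegral_sq_eq_one Ψ hΦ0 hΨΦ) hK0 hK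

/-- **Entropic Penrose–Onsager criterion for trial states (mutual-information direction).**
Same setting; if `KL(𝐏 ‖ 𝐐) ≤ K` then `(n+1) · e^{-K} ≤ maxOccupation (n+1) Ψ.ψ`.  For `g²` the
one-particle density this is the one-vs-rest mutual information of `|Φ|²`. -/
theorem mul_exp_neg_le_maxOccupation_of_klDiv_symm_le {n : ℕ} {L : ℝ} (Ψ : TrialState (n + 1) L)
    {Φ : Config (n + 1) → ℝ} (hΦ0 : 0 ≤ Φ) (hΨΦ : Ψ.ψ = fun X => (Φ X : ℂ))
    {g : Space → ℝ} (hg0 : 0 ≤ g) (hgm : Measurable g)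
    (hint : ∀ Y : Config n, Integrable (fun x => g x * Φ (Matrix.vecCons x Y)))
    (hg1 : ∫⁻ x, ENNReal.ofReal (g x) ^ 2 = 1) {K : ℝ} (hK0 : 0 ≤ K)
    (hK : klDiv
        (((volume : Measure Space).prod (volume : Measure (Config n))).withDensity
          fun z => ENNReal.ofReal (Φ (Matrix.vecCons z.1 z.2)) ^ 2)
        (((volume : Measure Space).prod (volume : Measure (Config n))).withDensity
          fun z => ENNReal.ofReal (g z.1) ^ 2 *
            ∫⁻ y, ENNReal.ofReal (Φ (Matrix.vecCons y z.2)) ^ 2) ≤ ENNReal.ofReal K) :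
    (n + 1 : ℝ≥0∞) * ENNReal.ofReal (Real.exp (-K)) ≤ maxOccupation (n + 1) Ψ.ψ := by
  rw [hΨΦ]
  exact Theorems.mul_exp_neg_le_maxOccupation_of_klDiv_symm_le hg0 hΦ0 hgm
    (measurable_of_eq_ofReal Ψ hΨΦ) hint hg1 (lintegral_lintegral_sq_eq_one Ψ hΦ0 hΨΦ) hK0 hK

/-- Small-entropy / small-information versions without a finiteness hypothesis:
`(n+1)(1 - KL/2)² ≤ maxOccupation (n+1) Ψ.ψ` for both orders of the arguments of `KL`. -/
theorem mul_one_sub_klDiv_sq_le_maxOccupation {n : ℕ} {L : ℝ} (Ψ : TrialState (n + 1) L)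
    {Φ : Config (n + 1) → ℝ} (hΦ0 : 0 ≤ Φ) (hΨΦ : Ψ.ψ = fun X => (Φ X : ℂ))
    {g : Space → ℝ} (hg0 : 0 ≤ g) (hgm : Measurable g)
    (hint : ∀ Y : Config n, Integrable (fun x => g x * Φ (Matrix.vecCons x Y)))
    (hg1 : ∫⁻ x, ENNReal.ofReal (g x) ^ 2 = 1) :
    (n + 1 : ℝ≥0∞) *
        (1 - klDiv
            (((volume : Measure Space).prod (volume : Measure (Config n))).withDensity
              fun z => ENNReal.ofReal (g z.1) ^ 2 *
                ∫⁻ y, ENNReal.ofReal (Φ (Matrix.vecCons y z.2)) ^ 2)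
            (((volume : Measure Space).prod (volume : Measure (Config n))).withDensity
              fun z => ENNReal.ofReal (Φ (Matrix.vecCons z.1 z.2)) ^ 2) / 2) ^ 2 ≤
      maxOccupation (n + 1) Ψ.ψ ∧
    (n + 1 : ℝ≥0∞) *
        (1 - klDiv
            (((volume : Measure Space).prod (volume : Measure (Config n))).withDensity
              fun z => ENNReal.ofReal (Φ (Matrix.vecCons z.1 z.2)) ^ 2)
            (((volume : Measure Space).prod (volume : Measure (Config n))).withDensity
              fun z => ENNReal.ofReal (g z.1) ^ 2 *
                ∫⁻ y, ENNReal.ofReal (Φ (Matrix.vecCons y z.2)) ^ 2) / 2) ^ 2 ≤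
      maxOccupation (n + 1) Ψ.ψ := by
  rw [hΨΦ]
  exact ⟨Theorems.mul_one_sub_klDiv_sq_le_maxOccupation hg0 hΦ0 hgm
      (measurable_of_eq_ofReal Ψ hΨΦ) hint hg1 (lintegral_lintegral_sq_eq_one Ψ hΦ0 hΨΦ),
    Theorems.mul_one_sub_klDiv_symm_sq_le_maxOccupation hg0 hΦ0 hgm
      (measurable_of_eq_ofReal Ψ hΨΦ) hint hg1 (lintegral_lintegral_sq_eq_one Ψ hΦ0 hΨΦ)⟩

end TrialState

end Summit.AtomisticToContinuum.BoseEinsteinCondensation.Theorems
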